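import Summits.ValiantsHypothesis.ValiantsHypothesis.Theorems.KPlusLogSqLawTropicalBNoFreePolygon

/-!
# Route «KPlusLogSqLaw», crux `TropicalB` (stmt-ValiantsHypothesis-19771) — NO MULTI-DOCKING DECOMPOSITION: two single-token activation
# cycles over a common state admit no partition into pieces that dock (any number of pieces) — the value-and-bookkeeping half of
# «two activation cycles meet in ONE common directed stretch»

HONEST FRAMING.  Helper toward the registered stubs `stub_tropThin` / `stub_tropFat` of `Cruxes/TropicalB/Lines/birth.lean` (crux
`Summit.ValiantsHypothesis.ValiantsHypothesis.Theses.KPlusLogSqLaw.TropicalB`, item stmt-ValiantsHypothesis-19771, route KPlusLogSqLaw;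
cell `pub-symmetroid`, seat val-sym-trop-p5 g25, refuter-adjacent lane, 2026-08-29; `--supports … --as helper`).  A STRUCTURE law about
unique optima (`IsDominant`) of an ARBITRARY dominance design; nothing here bounds `TropicalB`, and nothing bears on `WeakLifting`,
DoorA26 / DoorA34, `MatrixDescartes` (stmt-ValiantsHypothesis-18050) or VP ≠ VNP.

THE LAW (`MultiDocking.no_multi_docking`).  `P` (unique optimum at `θP`) and `Q` (at `θQ`) are SINGLE-TOKEN ACTIVATIONS over the base
`B` (unique optimum at `θB`): exponents equal to `B`'s off the token columns `eP`, `eQ`, larger there; `ρ_X = σ_B⁻¹σ_X` permutes the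
deviation set of `X` (its exchange cycle `Z_X`).  Suppose the deviation of `P` is partitioned into `ρ_P`-arcs `A a` (`a : α`, any nonempty
finite index type; every `A a` made of deviating columns) and that of `Q` into `ρ_Q`-arcs `D a`, such that EVERY PIECE DOCKS — `A a ∩ D a = ∅`,
the exit of `A a` docks onto the terminal of `D a` and the exit of `D a` onto the terminal of `A a` (the hypotheses of `Docking.docking`
over `Bool`) — non-degenerately (`Q ≠ P` somewhere on `D a`, `P ≠ Q` somewhere on `A a`).  THEN THERE IS NO SUCH DECOMPOSITION.
Instances: 2 pieces = the parallel double contact (`…TropicalBParallelContact`); for a common stretch `c₁ … c_r` traversed by the two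
cycles in OPPOSITE directions the `r − 1` two-cycles `c_i ⇄ c_{i+1}` together with the two private returns are `r` pieces; the contact of
order type «shift by 2 on five common columns» has a 3-piece decomposition (memo HOME/val-sym-trop-p5/g25/CONTACT-LAWS-g25.md §2).
Proof: the pieces are present terms `T a = (P on A a, Q on D a, B elsewhere)` (`Docking.docking`); column by column
`Σ_a f(T a i) = f(P i) + f(Q i) + (r−2)·f(B i)` for every per-cell weight (`FreePolygon.sum_eq_of_two/one/none`), so the valuations satisfy
the decomposition identity and the two slope increments are distributed over the pieces (`J a ⊆ {P, Q}` records which token columns the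
piece holds) — contradicting `Deficit.no_multi_reassembly` (`…TropicalBReassemblyDeficit`).  WHAT THIS LEAVES of conjecture C2 of the memo
(«two single-token activation cycles over a common state meet in exactly ONE common directed stretch»; located: 53/53, 21/21, 11/11, 4/4
pairs in the cell's four kernel cubes): the pure graph lemma that every other contact pattern of two cycles admits a decomposition into
docking pieces.

[folklore ingredients (cycle surgery, lower hulls); the packaging is the cell's, no citation exists]
-/

set_option linter.dupNamespace false
set_option autoImplicit false

namespace Summit.ValiantsHypothesis.ValiantsHypothesis.Theorems.KPlusLogSqLaw

namespace MultiDocking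

open Summit.ValiantsHypothesis.ValiantsHypothesis.Theorems.MatrixDescartes.Negative
open Summit.ValiantsHypothesis.ValiantsHypothesis.Theorems.LacunarySymmetroidMatrixDescartes
open Finset
open scoped BigOperators

variable {m K : ℕ} {α : Type*} [Fintype α] [DecidableEq α]

/-- **NO MULTI-DOCKING DECOMPOSITION OF TWO ACTIVATIONS.**  `P` (unique optimum at `θP`) and `Q` (at `θQ`) are single-token activations over
the base `B` (unique optimum at `θB`): exponents equal to `B`'s off the token columns `eP`, `eQ`, larger there.  Suppose the deviation of
`P` is partitioned into `ρ_P`-arcs `A a` and that of `Q` into `ρ_Q`-arcs `D a` (`a : α`, at least one piece; `ρ_X = σ_B⁻¹σ_X`; every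
`A a` consists of deviating columns) such that EVERY PIECE DOCKS: `A a ∩ D a = ∅`, the exit of `A a` docks onto the terminal of `D a` and
the exit of `D a` onto the terminal of `A a` (`Docking.docking` over `Bool`), non-degenerately (`Q ≠ P` somewhere on `D a`, `P ≠ Q`
somewhere on `A a`).  THEN THERE IS NO SUCH DECOMPOSITION.  Two pieces = the parallel double contact (`…TropicalBParallelContact`);
`r` pieces = the bigon decomposition of a common stretch traversed in OPPOSITE directions (each 2-cycle `c_i ⇄ c_{i+1}` is a piece, the two
private returns form the last piece), the 3-piece decomposition of the `k = 5` «shift-2» contact, … (memo CONTACT-LAWS-g25.md §2).  Proof: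
the pieces are present terms `T a = (P on A a, Q on D a, B elsewhere)`; column by column `Σ_a f(T a i) = f(P i) + f(Q i) + (r−2)·f(B i)`, so
the valuations satisfy the decomposition identity and the two increments are distributed over the pieces — contradicting
`Deficit.no_multi_reassembly`.  WHAT THIS LEAVES OF CONJECTURE C2 («two single-token activation cycles over a common state meet in ONE
common directed stretch»): the pure graph lemma that any other contact pattern of two cycles admits a decomposition into dockings.
[this cell; folklore ingredients] -/
theorem no_multi_docking [Nonempty α] (d : Fin K → ℕ) (v ε : Fin m → Fin m → Fin K → ℤ) {θB θP θQ : ℤ}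
    {B P Q : Equiv.Perm (Fin m) × (Fin m → Fin K)}
    (hB : IsDominant d v ε θB B) (hP : IsDominant d v ε θP P) (hQ : IsDominant d v ε θQ Q)
    (eP eQ : Fin m) (hcP : ∀ i, i ≠ eP → d (P.2 i) = d (B.2 i)) (hcQ : ∀ i, i ≠ eQ → d (Q.2 i) = d (B.2 i))
    (hδP : d (B.2 eP) < d (P.2 eP)) (hδQ : d (B.2 eQ) < d (Q.2 eQ))
    (A D : α → Finset (Fin m)) (xA tA xD tD : α → Fin m)
    (hAA : ∀ a b, a ≠ b → Disjoint (A a) (A b)) (hDD : ∀ a b, a ≠ b → Disjoint (D a) (D b)) (hAD : ∀ a, Disjoint (A a) (D a))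
    (hAdev : ∀ a, ∀ i ∈ A a, ¬ (P.1 i = B.1 i ∧ P.2 i = B.2 i))
    (hcovP : ∀ i, (∀ a, i ∉ A a) → P.1 i = B.1 i ∧ P.2 i = B.2 i) (hcovQ : ∀ i, (∀ a, i ∉ D a) → Q.1 i = B.1 i ∧ Q.2 i = B.2 i)
    (htA : ∀ a, tA a ∈ A a) (htD : ∀ a, tD a ∈ D a)
    (hinA : ∀ a, ∀ i ∈ A a, i ≠ xA a → B.1.symm (P.1 i) ∈ A a ∧ B.1.symm (P.1 i) ≠ tA a)
    (hinD : ∀ a, ∀ i ∈ D a, i ≠ xD a → B.1.symm (Q.1 i) ∈ D a ∧ B.1.symm (Q.1 i) ≠ tD a)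
    (hxA : ∀ a, B.1.symm (P.1 (xA a)) = tD a) (hxD : ∀ a, B.1.symm (Q.1 (xD a)) = tA a)
    (hndP : ∀ a, ∃ i ∈ D a, ¬ (Q.1 i = P.1 i ∧ Q.2 i = P.2 i)) (hndQ : ∀ a, ∃ i ∈ A a, ¬ (P.1 i = Q.1 i ∧ P.2 i = Q.2 i)) : False := by
  classical
  -- the pieces, by the docking lemma over `Bool` (`true` = the `P`-arc)
  let PQ : Bool → Equiv.Perm (Fin m) × (Fin m → Fin K) := fun b => if b then P else Q
  have hpiece : ∀ a, ∃ T : Equiv.Perm (Fin m) × (Fin m → Fin K),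
      (∀ i ∈ A a, T.1 i = P.1 i ∧ T.2 i = P.2 i) ∧ (∀ i ∈ D a, T.1 i = Q.1 i ∧ T.2 i = Q.2 i) ∧
      (∀ i, i ∉ A a → i ∉ D a → T.1 i = B.1 i ∧ T.2 i = B.2 i) := by
    intro a
    obtain ⟨T, hTin, hTout⟩ := Docking.docking (ι := Bool) B PQ (fun b => if b then A a else D a)
      (fun b => if b then xA a else xD a) (fun b => if b then tA a else tD a) (Equiv.swap true false)
      (by intro j j' hjj'; cases j <;> cases j' <;> simp_all [disjoint_comm])
      (by intro j; cases j <;> simp [htA, htD])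
      (by
        intro j i hi hix
        cases j
        · simp only [Bool.false_eq_true, ↓reduceIte] at hi hix ⊢; exact hinD a i hi hix
        · simp only [↓reduceIte] at hi hix ⊢; exact hinA a i hi hix)
      (by
        intro j; cases j
        · simp only [Bool.false_eq_true, ↓reduceIte, Equiv.swap_apply_right]; exact hxD a
        · simp only [↓reduceIte, Equiv.swap_apply_left, Bool.false_eq_true]; exact hxA a)
    refine ⟨T, fun i hi => by simpa [PQ] using hTin true i (by simpa using hi),
      fun i hi => by simpa [PQ] using hTin false i (by simpa using hi), fun i hA hD => hTout i (fun j => by cases j <;> simpa)⟩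
  choose T hTA hTD hTB using hpiece
  -- uniqueness of the pieces containing a column
  have uA : ∀ {i : Fin m} {a b : α}, i ∈ A a → i ∈ A b → a = b := by
    intro i a b ha hb; by_contra hne; exact disjoint_left.mp (hAA a b hne) ha hb
  have uD : ∀ {i : Fin m} {a b : α}, i ∈ D a → i ∈ D b → a = b := by
    intro i a b ha hb; by_contra hne; exact disjoint_left.mp (hDD a b hne) ha hb
  -- per-column identity for every per-cell weight
  have col : ∀ (f : Fin m → Fin m → Fin K → ℤ) (i : Fin m),
      ∑ a, f ((T a).1 i) i ((T a).2 i) = f (P.1 i) i (P.2 i) + f (Q.1 i) i (Q.2 i) + ((Fintype.card α : ℤ) - 2) * f (B.1 i) i (B.2 i) := by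
    intro f i
    by_cases hiA : ∃ a, i ∈ A a <;> by_cases hiD : ∃ b, i ∈ D b
    · obtain ⟨a, ha⟩ := hiA
      obtain ⟨b, hb⟩ := hiD
      have hab : a ≠ b := fun h => disjoint_left.mp (hAD a) ha (h ▸ hb)
      have hl : ∀ c, c ≠ a → c ≠ b → f ((T c).1 i) i ((T c).2 i) = f (B.1 i) i (B.2 i) := by
        intro c hca hcb
        obtain ⟨e1, e2⟩ := hTB c i (fun h => hca (uA h ha)) (fun h => hcb (uD h hb))
        rw [e1, e2]
      rw [FreePolygon.sum_eq_of_two a b hab hl, (hTA a i ha).1, (hTA a i ha).2, (hTD b i hb).1, (hTD b i hb).2]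
    · obtain ⟨a, ha⟩ := hiA
      have hnD : ∀ b, i ∉ D b := fun b h => hiD ⟨b, h⟩
      have hl : ∀ c, c ≠ a → f ((T c).1 i) i ((T c).2 i) = f (B.1 i) i (B.2 i) := by
        intro c hca
        obtain ⟨e1, e2⟩ := hTB c i (fun h => hca (uA h ha)) (hnD c)
        rw [e1, e2]
      obtain ⟨q1, q2⟩ := hcovQ i hnD
      rw [FreePolygon.sum_eq_of_one a hl, (hTA a i ha).1, (hTA a i ha).2, q1, q2]; ring
    · obtain ⟨b, hb⟩ := hiD
      have hnA : ∀ a, i ∉ A a := fun a h => hiA ⟨a, h⟩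
      have hl : ∀ c, c ≠ b → f ((T c).1 i) i ((T c).2 i) = f (B.1 i) i (B.2 i) := by
        intro c hcb
        obtain ⟨e1, e2⟩ := hTB c i (hnA c) (fun h => hcb (uD h hb))
        rw [e1, e2]
      obtain ⟨p1, p2⟩ := hcovP i hnA
      rw [FreePolygon.sum_eq_of_one b hl, (hTD b i hb).1, (hTD b i hb).2, p1, p2]; ring
    · have hnA : ∀ a, i ∉ A a := fun a h => hiA ⟨a, h⟩
      have hnD : ∀ b, i ∉ D b := fun b h => hiD ⟨b, h⟩
      have hl : ∀ c, f ((T c).1 i) i ((T c).2 i) = f (B.1 i) i (B.2 i) := by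
        intro c
        obtain ⟨e1, e2⟩ := hTB c i (hnA c) (hnD c)
        rw [e1, e2]
      obtain ⟨p1, p2⟩ := hcovP i hnA
      obtain ⟨q1, q2⟩ := hcovQ i hnD
      rw [FreePolygon.sum_eq_of_none hl, p1, p2, q1, q2]; ring
  -- presence and non-degeneracy of the pieces
  have hTpres : ∀ a, termSign ε (T a) ≠ 0 := by
    intro a
    rw [termSign_ne_zero_iff]
    intro i
    by_cases hiA : i ∈ A a
    · rw [(hTA a i hiA).1, (hTA a i hiA).2]; exact (termSign_ne_zero_iff ε P).1 hP.1 i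
    by_cases hiD : i ∈ D a
    · rw [(hTD a i hiD).1, (hTD a i hiD).2]; exact (termSign_ne_zero_iff ε Q).1 hQ.1 i
    · rw [(hTB a i hiA hiD).1, (hTB a i hiA hiD).2]; exact (termSign_ne_zero_iff ε B).1 hB.1 i
  have hT_ne_B : ∀ a, T a ≠ B := by
    intro a h
    obtain ⟨i, hi, hne⟩ := hndQ a
    have := hAdev a i hi
    exact this ⟨by rw [← (hTA a i hi).1, h], by rw [← (hTA a i hi).2, h]⟩
  have hT_ne_P : ∀ a, T a ≠ P := by
    intro a h
    obtain ⟨i, hi, hne⟩ := hndP a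
    exact hne ⟨by rw [← (hTD a i hi).1, h], by rw [← (hTD a i hi).2, h]⟩
  have hT_ne_Q : ∀ a, T a ≠ Q := by
    intro a h
    obtain ⟨i, hi, hne⟩ := hndQ a
    exact hne ⟨by rw [← (hTA a i hi).1, h], by rw [← (hTA a i hi).2, h]⟩
  -- the token columns lie in exactly one piece each
  have heP : ∃ a, eP ∈ A a := by
    by_contra h
    push Not at h
    have := (hcovP eP h).2
    have hlt := hδP; rw [this] at hlt; exact lt_irrefl _ hlt
  have heQ : ∃ a, eQ ∈ D a := by
    by_contra h
    push Not at h
    have := (hcovQ eQ h).2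
    have hlt := hδQ; rw [this] at hlt; exact lt_irrefl _ hlt
  -- slopes of the pieces
  have hsP := Docking.slope_eq_of_concentrated d B P eP hcP
  have hsQ := Docking.slope_eq_of_concentrated d B Q eQ hcQ
  have slopeT : ∀ a, TropicalCensus.slope d (T a) = TropicalCensus.slope d B
      + (if eP ∈ A a then TropicalCensus.slope d P - TropicalCensus.slope d B else 0)
      + (if eQ ∈ D a then TropicalCensus.slope d Q - TropicalCensus.slope d B else 0) := by
    intro a
    have key : ∀ i ∈ (univ : Finset (Fin m)), ((d ((T a).2 i)) : ℤ) = (d (B.2 i) : ℤ)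
        + (if i = eP ∧ eP ∈ A a then ((d (P.2 eP)) : ℤ) - d (B.2 eP) else 0)
        + (if i = eQ ∧ eQ ∈ D a then ((d (Q.2 eQ)) : ℤ) - d (B.2 eQ) else 0) := by
      intro i _
      by_cases hiA : i ∈ A a
      · have hiD : i ∉ D a := disjoint_left.mp (hAD a) hiA
        rw [(hTA a i hiA).2, if_neg (fun h : i = eQ ∧ eQ ∈ D a => hiD (h.1 ▸ h.2))]
        by_cases hie : i = eP
        · subst hie; rw [if_pos ⟨rfl, hiA⟩]; ring
        · rw [if_neg (fun h => hie h.1), hcP i hie]; ring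
      by_cases hiD : i ∈ D a
      · rw [(hTD a i hiD).2, if_neg (fun h : i = eP ∧ eP ∈ A a => hiA (h.1 ▸ h.2))]
        by_cases hie : i = eQ
        · subst hie; rw [if_pos ⟨rfl, hiD⟩]; ring
        · rw [if_neg (fun h => hie h.1), hcQ i hie]; ring
      · rw [(hTB a i hiA hiD).2, if_neg (fun h : i = eP ∧ eP ∈ A a => hiA (h.1 ▸ h.2)),
          if_neg (fun h : i = eQ ∧ eQ ∈ D a => hiD (h.1 ▸ h.2))]; ring
    unfold TropicalCensus.slope at *
    rw [sum_congr rfl key, sum_add_distrib, sum_add_distrib, sum_ite, sum_ite, sum_const_zero, sum_const_zero, add_zero, add_zero,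
      sum_const, sum_const, nsmul_eq_mul, nsmul_eq_mul]
    have cP : ((univ.filter fun i => i = eP ∧ eP ∈ A a).card : ℤ) = if eP ∈ A a then 1 else 0 := by
      by_cases h : eP ∈ A a
      · rw [if_pos h]
        have : (univ.filter fun i => i = eP ∧ eP ∈ A a) = {eP} := by
          ext i; simp [h]
        rw [this, card_singleton]; simp
      · rw [if_neg h]
        have : (univ.filter fun i => i = eP ∧ eP ∈ A a) = ∅ := by
          ext i; simp [h]
        rw [this, card_empty]; simp
    have cQ : ((univ.filter fun i => i = eQ ∧ eQ ∈ D a).card : ℤ) = if eQ ∈ D a then 1 else 0 := by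
      by_cases h : eQ ∈ D a
      · rw [if_pos h]
        have : (univ.filter fun i => i = eQ ∧ eQ ∈ D a) = {eQ} := by
          ext i; simp [h]
        rw [this, card_singleton]; simp
      · rw [if_neg h]
        have : (univ.filter fun i => i = eQ ∧ eQ ∈ D a) = ∅ := by
          ext i; simp [h]
        rw [this, card_empty]; simp
    rw [cP, cQ, hsP, hsQ]
    split_ifs <;> ring
  -- assemble `Deficit.no_multi_reassembly` with the index type `Bool`
  have hPQdom : ∀ b, IsDominant d v ε ((fun b => if b then θP else θQ) b) (PQ b) := by
    intro b; cases b
    · simpa [PQ] using hQ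
    · simpa [PQ] using hP
  have hδ : ∀ b, TropicalCensus.slope d B < TropicalCensus.slope d (PQ b) := by
    intro b; cases b
    · simp only [PQ, Bool.false_eq_true, ↓reduceIte]; rw [hsQ]
      have := hδQ; linarith [show ((d (B.2 eQ) : ℕ) : ℤ) < d (Q.2 eQ) by exact_mod_cast this]
    · simp only [PQ, ↓reduceIte]; rw [hsP]
      have := hδP; linarith [show ((d (B.2 eP) : ℕ) : ℤ) < d (P.2 eP) by exact_mod_cast this]
  let J : α → Finset Bool := fun a => (if eP ∈ A a then {true} else ∅) ∪ (if eQ ∈ D a then {false} else ∅)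
  have hJmem : ∀ a b, b ∈ J a ↔ (b = true ∧ eP ∈ A a) ∨ (b = false ∧ eQ ∈ D a) := by
    intro a b
    simp only [J, mem_union]
    constructor
    · rintro (h | h)
      · by_cases hh : eP ∈ A a
        · rw [if_pos hh, mem_singleton] at h; exact Or.inl ⟨h, hh⟩
        · rw [if_neg hh] at h; exact absurd h (Finset.notMem_empty _)
      · by_cases hh : eQ ∈ D a
        · rw [if_pos hh, mem_singleton] at h; exact Or.inr ⟨h, hh⟩
        · rw [if_neg hh] at h; exact absurd h (Finset.notMem_empty _)
    · rintro (⟨rfl, hh⟩ | ⟨rfl, hh⟩)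
      · left; rw [if_pos hh]; exact mem_singleton_self _
      · right; rw [if_pos hh]; exact mem_singleton_self _
  have hJdisj : ∀ a b, a ≠ b → Disjoint (J a) (J b) := by
    intro a b hab
    rw [disjoint_left]
    intro x hxa hxb
    rcases (hJmem a x).1 hxa with ⟨rfl, ha⟩ | ⟨rfl, ha⟩ <;> rcases (hJmem b _).1 hxb with ⟨h, hb⟩ | ⟨h, hb⟩
    · exact hab (uA ha hb)
    · exact Bool.noConfusion h
    · exact Bool.noConfusion h
    · exact hab (uD ha hb)
  have hJcover : ∀ b : Bool, ∃ a, b ∈ J a := by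
    intro b; cases b
    · obtain ⟨a, ha⟩ := heQ; exact ⟨a, (hJmem a false).2 (Or.inr ⟨rfl, ha⟩)⟩
    · obtain ⟨a, ha⟩ := heP; exact ⟨a, (hJmem a true).2 (Or.inl ⟨rfl, ha⟩)⟩
  have hsJ : ∀ a, TropicalCensus.slope d (T a) =
      TropicalCensus.slope d B + ∑ j ∈ J a, (TropicalCensus.slope d (PQ j) - TropicalCensus.slope d B) := by
    intro a
    rw [slopeT a]
    have : ∑ j ∈ J a, (TropicalCensus.slope d (PQ j) - TropicalCensus.slope d B) =
        (if eP ∈ A a then TropicalCensus.slope d P - TropicalCensus.slope d B else 0)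
        + (if eQ ∈ D a then TropicalCensus.slope d Q - TropicalCensus.slope d B else 0) := by
      simp only [J]
      (by_cases h1 : eP ∈ A a <;> by_cases h2 : eQ ∈ D a <;> simp [h1, h2, PQ]); ring
    rw [this]; ring
  have key := Deficit.no_multi_reassembly d v ε (fun b => if b then θP else θQ) PQ hB hPQdom hδ T hTpres hT_ne_B
    (fun a b => by cases b <;> simpa [PQ] using (by first | exact hT_ne_Q a | exact hT_ne_P a)) J hJdisj hJcover hsJ
  -- the valuation identity contradicts the deficit
  have hV : ∑ a, ∑ i, v ((T a).1 i) i ((T a).2 i) = (∑ i, v (P.1 i) i (P.2 i)) + (∑ i, v (Q.1 i) i (Q.2 i))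
      + ((Fintype.card α : ℤ) - 2) * ∑ i, v (B.1 i) i (B.2 i) := by
    rw [sum_comm, mul_sum, ← sum_add_distrib, ← sum_add_distrib]
    exact sum_congr rfl fun i _ => col v i
  have lhs : ∑ j, ((∑ i, v ((PQ j).1 i) i ((PQ j).2 i)) - ∑ i, v (B.1 i) i (B.2 i)) =
      (∑ i, v (P.1 i) i (P.2 i)) + (∑ i, v (Q.1 i) i (Q.2 i)) - 2 * ∑ i, v (B.1 i) i (B.2 i) := by
    rw [Fintype.sum_bool]; simp only [PQ, ↓reduceIte, Bool.false_eq_true]; ring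
  have rhs : ∑ a, ((∑ i, v ((T a).1 i) i ((T a).2 i)) - ∑ i, v (B.1 i) i (B.2 i)) =
      (∑ a, ∑ i, v ((T a).1 i) i ((T a).2 i)) - (Fintype.card α : ℤ) * ∑ i, v (B.1 i) i (B.2 i) := by
    rw [sum_sub_distrib, sum_const, card_univ, nsmul_eq_mul]
  rw [lhs, rhs, hV] at key
  linarith

end MultiDocking

end Summit.ValiantsHypothesis.ValiantsHypothesis.Theorems.KPlusLogSqLaw
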